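import Summits.NavierStokesRegularity.NavierStokesRegularity.Theorems.OddMorawetzLocal.Negative.OddMorawetzLocalRefutationData5
import Summits.NavierStokesRegularity.NavierStokesRegularity.Theorems.OddMorawetzLocal.Negative.OddMorawetzLocalRefutationDefsV
import HarnessLib

/-!
# Crux `OddMorawetzLocal` (stmt-NavierStokesRegularity-1376) — kernel certificates, weight 5 (part A3a)

The finite computations of the weight-5 half of the refutation, each a closed Boolean evaluated by the kernel
(`decide +kernel`) on the vocabulary of `OddMorawetzLocalJetAlgebra` / `…RefutationDefs{,Fast,IV,V}` and the literal
data of `…RefutationData5` (197 orbit representatives `reps5`, 50 isotropic descriptors `isoDesc5`, three certificate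
blocks `blocks5` of sizes 53/45/49, the independence columns `kcols5` and inverse `cinv5`, prime 8191).
Part A3: `cert5_e1_*` — the orbit-sum identities `e1Check 5 reps5 lo n` (step E1: a `B₃`-fixed coefficient vector lies in
the span of the 197 normalised orbit sums) for the basis monomials of the listed ranges, in chunks of 100 (kernel memory).
No analysis; lands `--supports` the crux item; consumed by the weight-5 assembly of the refutation.
-/

set_option linter.dupNamespace false

namespace Summit.NavierStokesRegularity.NavierStokesRegularity.Theorems.OddMorawetz

/-- Orbit-sum identities for the weight-5 basis monomials `3200 … 3299`. -/
theorem cert5_e1_32 : e1Check 5 reps5 3200 100 = true := by decide +kernel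

/-- Orbit-sum identities for the weight-5 basis monomials `3300 … 3399`. -/
theorem cert5_e1_33 : e1Check 5 reps5 3300 100 = true := by decide +kernel

/-- Orbit-sum identities for the weight-5 basis monomials `3400 … 3499`. -/
theorem cert5_e1_34 : e1Check 5 reps5 3400 100 = true := by decide +kernel

/-- Orbit-sum identities for the weight-5 basis monomials `3500 … 3599`. -/
theorem cert5_e1_35 : e1Check 5 reps5 3500 100 = true := by decide +kernel

/-- Orbit-sum identities for the weight-5 basis monomials `3600 … 3699`. -/
theorem cert5_e1_36 : e1Check 5 reps5 3600 100 = true := by decide +kernel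

/-- Orbit-sum identities for the weight-5 basis monomials `3700 … 3799`. -/
theorem cert5_e1_37 : e1Check 5 reps5 3700 100 = true := by decide +kernel

/-- Orbit-sum identities for the weight-5 basis monomials `3800 … 3899`. -/
theorem cert5_e1_38 : e1Check 5 reps5 3800 100 = true := by decide +kernel

/-- Orbit-sum identities for the weight-5 basis monomials `3900 … 3999`. -/
theorem cert5_e1_39 : e1Check 5 reps5 3900 100 = true := by decide +kernel

end Summit.NavierStokesRegularity.NavierStokesRegularity.Theorems.OddMorawetz
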